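import Summits.CriticalPhenomena.Ising3D.Control2DIsingPositivity
import Summits.CriticalPhenomena.Ising3D.Control2DIsingTaylor
import Summits.CriticalPhenomena.Ising3D.Control2DGFFChiral
import Mathlib.Analysis.Normed.Ring.InfiniteSum
import Mathlib.Tactic
import HarnessLib

/-!
# The 2D Ising witness, VI: the `c = 1/2` Virasoro blocks as non-negative `sl(2)` block series
(cell `pub-ising3x`, seat controls-1 gen 37; NON-VACUITY of the 2D control's `A2D′` classes at
`Δ_σ = 1/8` by the Ising datum, step 6 — CONTROL-ONLY)

HONEST FRAMING: lottery ticket; floor = tightest certified 3D Ising CFT bounds; no exact-solution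
claim without a proof. CONTROL-ONLY (`d = 2`); elementary real analysis only.

For `0 < x < 1`:

* `hasSum_isingA_blocks` : `Σ_j A_j k_{4j}(x)   = f₁(x) = (1-x)^{-1/8} (√(1+√x) + √(1-√x))/2`,
* `hasSum_isingB_blocks` : `Σ_j B_j k_{4j+1}(x) = f₂(x) = (1-x)^{-1/8} (√(1+√x) - √(1-√x))/2`,

with `A_j > 0`, `B_j ≥ 0` the recursively defined coefficients of `Control2DIsingSequences` — the
quasi-primary (global-block) expansions of the two `c = 1/2` Virasoro blocks of `⟨σσσσ⟩`
(Belavin–Polyakov–Zamolodchikov 1984, §5/App. E; in the variable `θ`, `x = sin²θ`, these are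
`(cos θ)^{-1/4} cos(θ/2)` and `(cos θ)^{-1/4} sin(θ/2)`). Method: Mathlib's binomial series gives
`√(1 ± √x) = Σ_n (-1/2)_n/n! (∓√x)^n`, whose even/odd parts are `w₁ = Σ ω₁(n) xⁿ`, `w₂ = √x Σ ω₂(n) xⁿ`;
the Cauchy product with `(1-x)^{-1/8} = Σ β_k x^k` has coefficients `conv β ω`, which by
`Control2DIsingTaylor` ARE the `x`-coefficients `famCoeff` of the block series; Tonelli on the
non-negative double family `(j, m) ↦ c_j κ_{h_j}(m) x^{h_j+m}` (re-indexed along `N = 2j + m`) then sums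
the block series (`hasSum_blocks_of_famCoeff`, generic in the family). No special-function identity is
used beyond the binomial series.

References: A. A. Belavin, A. M. Polyakov, A. B. Zamolodchikov, Nucl. Phys. B 241 (1984) 333, §5, App. E
[cite: BelavinPolyakovZamolodchikov1984, App. E]. Tree: `hasSum_chiralBlock`, `chiralCoeff_nonneg`,
`hasSum_poch_div_factorial_mul_pow` (binomial series), `famCoeff_isingA/B`, `isingA_nonneg`, `isingB_nonneg`;
Mathlib: `tsum_mul_tsum_eq_tsum_sum_antidiagonal_of_summable_norm`, `summable_prod_of_nonneg`,
`Function.Injective.hasSum_iff`.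
-/

namespace Summit.CriticalPhenomena.Ising3D.Control2D

open Finset Set
open Literature.MathematicalPhysics.QuantumFieldTheory.ConformalBootstrap3D

/-! ### The closed forms -/

/-- `w₁(x) = (√(1+√x) + √(1-√x))/2` (`= cos(θ/2)` at `x = sin²θ`; `= ₂F₁(1/4,-1/4;1/2;x)`). [cite: BelavinPolyakovZamolodchikov1984, App. E] -/
noncomputable def isingW₁ (x : ℝ) : ℝ := (Real.sqrt (1 + Real.sqrt x) + Real.sqrt (1 - Real.sqrt x)) / 2

/-- `w₂(x) = (√(1+√x) - √(1-√x))/2` (`= sin(θ/2)` at `x = sin²θ`). [cite: BelavinPolyakovZamolodchikov1984, App. E] -/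
noncomputable def isingW₂ (x : ℝ) : ℝ := (Real.sqrt (1 + Real.sqrt x) - Real.sqrt (1 - Real.sqrt x)) / 2

/-- **The `c = 1/2` identity Virasoro block of `⟨σσσσ⟩`**: `f₁(x) = (1-x)^{-1/8} w₁(x)`.
[cite: BelavinPolyakovZamolodchikov1984, App. E] -/
noncomputable def isingF₁ (x : ℝ) : ℝ := 1 / (1 - x) ^ (1 / 8 : ℝ) * isingW₁ x

/-- **The `c = 1/2` `ε` Virasoro block of `⟨σσσσ⟩`**: `f₂(x) = (1-x)^{-1/8} w₂(x)`.
[cite: BelavinPolyakovZamolodchikov1984, App. E] -/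
noncomputable def isingF₂ (x : ℝ) : ℝ := 1 / (1 - x) ^ (1 / 8 : ℝ) * isingW₂ x

section Series

variable {x : ℝ}

/-- `√(1 - t) = Σ_n (-1/2)_n/n! tⁿ` for `|t| < 1` (binomial series). [folklore] -/
theorem hasSum_sqrt_one_sub {t : ℝ} (ht : |t| < 1) :
    HasSum (fun n : ℕ => poch (-1 / 2) n / (n.factorial : ℝ) * t ^ n) (Real.sqrt (1 - t)) := by
  have h := hasSum_poch_div_factorial_mul_pow (-1 / 2) ht
  have h1 : 0 ≤ 1 - t := by linarith [(abs_lt.mp ht).2]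
  have e : 1 / (1 - t) ^ (-1 / 2 : ℝ) = Real.sqrt (1 - t) := by
    rw [show (-1 / 2 : ℝ) = -(1 / 2) by norm_num, Real.rpow_neg h1, one_div, inv_inv, Real.sqrt_eq_rpow]
  rwa [e] at h

/-- **`w₁ = Σ_n ω₁(n) xⁿ`** on `0 < x < 1` (even part of the binomial series at `∓√x`). [folklore] -/
theorem hasSum_isingW₁ (hx : x ∈ Ioo (0 : ℝ) 1) :
    HasSum (fun n : ℕ => isingOmega₁ n * x ^ n) (isingW₁ x) := by
  have hs0 : 0 ≤ Real.sqrt x := Real.sqrt_nonneg x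
  have hs1 : Real.sqrt x < 1 := by
    rw [show (1 : ℝ) = Real.sqrt 1 from Real.sqrt_one.symm]
    exact Real.sqrt_lt_sqrt hx.1.le hx.2
  have ha : |Real.sqrt x| < 1 := by rw [abs_of_nonneg hs0]; exact hs1
  have hb : |-Real.sqrt x| < 1 := by rw [abs_neg]; exact ha
  have hplus := hasSum_sqrt_one_sub hb
  rw [sub_neg_eq_add] at hplus
  have hminus := hasSum_sqrt_one_sub ha
  have hsum := (hplus.add hminus).div_const 2
  set f : ℕ → ℝ := fun n => (poch (-1 / 2) n / (n.factorial : ℝ) * (-Real.sqrt x) ^ n +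
    poch (-1 / 2) n / (n.factorial : ℝ) * Real.sqrt x ^ n) / 2 with hf
  have hzero : ∀ n ∉ Set.range (fun m : ℕ => 2 * m), f n = 0 := by
    intro n hn
    have hodd : Odd n := by
      rcases Nat.even_or_odd n with h | h
      · exfalso; apply hn; obtain ⟨m, hm⟩ := h; exact ⟨m, by show 2 * m = n; omega⟩
      · exact h
    simp only [hf, hodd.neg_pow]
    ring
  have hcomp : f ∘ (fun m : ℕ => 2 * m) = fun n : ℕ => isingOmega₁ n * x ^ n := by
    funext m
    simp only [Function.comp_apply, hf, isingOmega₁]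
    rw [pow_mul, pow_mul, neg_sq, Real.sq_sqrt hx.1.le]
    ring
  have key := (Function.Injective.hasSum_iff (f := f) (g := fun m : ℕ => 2 * m)
    (fun a b h => by simpa using h) hzero).2 hsum
  rw [hcomp] at key
  exact key

/-- **`w₂/√x = Σ_n ω₂(n) xⁿ`** on `0 < x < 1` (odd part of the binomial series). [folklore] -/
theorem hasSum_isingW₂ (hx : x ∈ Ioo (0 : ℝ) 1) :
    HasSum (fun n : ℕ => isingOmega₂ n * x ^ n) (isingW₂ x / Real.sqrt x) := by
  have hs : 0 < Real.sqrt x := Real.sqrt_pos.mpr hx.1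
  have hs1 : Real.sqrt x < 1 := by
    rw [show (1 : ℝ) = Real.sqrt 1 from Real.sqrt_one.symm]
    exact Real.sqrt_lt_sqrt hx.1.le hx.2
  have ha : |Real.sqrt x| < 1 := by rw [abs_of_nonneg hs.le]; exact hs1
  have hb : |-Real.sqrt x| < 1 := by rw [abs_neg]; exact ha
  have hplus := hasSum_sqrt_one_sub hb
  rw [sub_neg_eq_add] at hplus
  have hminus := hasSum_sqrt_one_sub ha
  have hsum := ((hplus.sub hminus).div_const 2).div_const (Real.sqrt x)
  set f : ℕ → ℝ := fun n => (poch (-1 / 2) n / (n.factorial : ℝ) * (-Real.sqrt x) ^ n -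
    poch (-1 / 2) n / (n.factorial : ℝ) * Real.sqrt x ^ n) / 2 / Real.sqrt x with hf
  have hzero : ∀ n ∉ Set.range (fun m : ℕ => 2 * m + 1), f n = 0 := by
    intro n hn
    have heven : Even n := by
      rcases Nat.even_or_odd n with h | h
      · exact h
      · exfalso; apply hn; obtain ⟨m, hm⟩ := h; exact ⟨m, by show 2 * m + 1 = n; omega⟩
    simp only [hf, heven.neg_pow]
    ring
  have hcomp : f ∘ (fun m : ℕ => 2 * m + 1) = fun n : ℕ => isingOmega₂ n * x ^ n := by
    funext m
    simp only [Function.comp_apply, hf, isingOmega₂]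
    rw [pow_succ, pow_succ, pow_mul, pow_mul, neg_sq, Real.sq_sqrt hx.1.le]
    field_simp
    ring
  have key := (Function.Injective.hasSum_iff (f := f) (g := fun m : ℕ => 2 * m + 1)
    (fun a b h => by simpa using h) hzero).2 hsum
  rw [hcomp] at key
  exact key

/-- `(1-x)^{-1/8} = Σ_k β_k x^k` on `0 < x < 1`. [folklore] -/
theorem hasSum_isingBeta (hx : x ∈ Ioo (0 : ℝ) 1) :
    HasSum (fun k : ℕ => isingBeta k * x ^ k) (1 / (1 - x) ^ (1 / 8 : ℝ)) :=
  hasSum_poch_div_factorial_mul_pow (1 / 8) (by rw [abs_of_pos hx.1]; exact hx.2)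

/-- **Cauchy product**: `Σ_N (β ∗ ω)(N) x^N = (1-x)^{-1/8} · W` whenever `Σ ω_n xⁿ = W` (`0 < x < 1`; both
factors absolutely summable). [folklore] -/
theorem hasSum_conv_isingBeta (hx : x ∈ Ioo (0 : ℝ) 1) {ω : ℕ → ℝ} {W : ℝ}
    (hW : HasSum (fun n : ℕ => ω n * x ^ n) W) :
    HasSum (fun N : ℕ => conv isingBeta ω N * x ^ N) (1 / (1 - x) ^ (1 / 8 : ℝ) * W) := by
  have hB := hasSum_isingBeta hx
  set fB : ℕ → ℝ := fun n => isingBeta n * x ^ n with hfB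
  set fW : ℕ → ℝ := fun n => ω n * x ^ n with hfW
  have hBn : Summable (fun n : ℕ => ‖fB n‖) := by
    simpa only [Real.norm_eq_abs] using hB.summable.abs
  have hWn : Summable (fun n : ℕ => ‖fW n‖) := by
    simpa only [Real.norm_eq_abs] using hW.summable.abs
  have hprod := tsum_mul_tsum_eq_tsum_sum_antidiagonal_of_summable_norm hBn hWn
  have hS : Summable (fun n : ℕ => ∑ kl ∈ antidiagonal n, fB kl.1 * fW kl.2) :=
    summable_sum_mul_antidiagonal_of_summable_norm' hBn hB.summable hWn hW.summable
  have hval : (∑' n : ℕ, ∑ kl ∈ antidiagonal n, fB kl.1 * fW kl.2) = 1 / (1 - x) ^ (1 / 8 : ℝ) * W := by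
    rw [← hprod, hB.tsum_eq, hW.tsum_eq]
  have H := hS.hasSum
  rw [hval] at H
  refine H.congr_fun ?_
  intro N
  rw [conv, sum_mul]
  refine sum_congr rfl fun kl hkl => ?_
  rw [HasAntidiagonal.mem_antidiagonal] at hkl
  simp only [hfB, hfW]
  rw [← hkl, pow_add]
  ring

end Series

section Tonelli

variable {x : ℝ}

/-! ### Tonelli: from the `x`-coefficients to the block series -/

/-- **Generic summation of a block family.** If `c ≥ 0`, the `x`-coefficients `famCoeff σ c` of
`Σ_j c_j k_{2(σ+2j)}` are the Cauchy coefficients `β ∗ ω`, and `Σ ω_n xⁿ = W`, then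
`Σ_j c_j k_{2(σ+2j)}(x) = x^σ (1-x)^{-1/8} W` (`0 < x < 1`; Tonelli on the non-negative double family
`c_j κ_{σ+2j}(m) x^{σ+2j+m}` re-indexed along `N = 2j + m`). [folklore] -/
theorem hasSum_blocks_of_famCoeff {σ : ℝ} (hσ : 0 ≤ σ) {c ω : ℕ → ℝ} (hc : ∀ j, 0 ≤ c j)
    (hT : ∀ N, famCoeff σ c N = conv isingBeta ω N) (hx : x ∈ Ioo (0 : ℝ) 1) {W : ℝ}
    (hW : HasSum (fun n : ℕ => ω n * x ^ n) W) :
    HasSum (fun j : ℕ => c j * chiralBlock (σ + 2 * j) x) (x ^ σ * (1 / (1 - x) ^ (1 / 8 : ℝ) * W)) := by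
  -- the diagonal totals
  have hdiag : HasSum (fun N : ℕ => famCoeff σ c N * x ^ (σ + (N : ℝ)))
      (x ^ σ * (1 / (1 - x) ^ (1 / 8 : ℝ) * W)) := by
    refine ((hasSum_conv_isingBeta hx hW).mul_left (x ^ σ)).congr_fun fun N => ?_
    rw [hT N, Real.rpow_add hx.1, Real.rpow_natCast]
    ring
  -- the double family and its re-indexing
  set F : ℕ × ℕ → ℝ := fun jm => c jm.1 * (chiralCoeff (σ + 2 * jm.1) jm.2 * x ^ (σ + 2 * jm.1 + (jm.2 : ℝ)))
    with hF
  set G : ℕ × ℕ → ℝ := fun Nj => if 2 * Nj.2 ≤ Nj.1 then F (Nj.2, Nj.1 - 2 * Nj.2) else 0 with hG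
  set r : ℕ × ℕ → ℕ × ℕ := fun jm => (2 * jm.1 + jm.2, jm.1) with hr
  have hrinj : Function.Injective r := by
    intro a b h
    simp only [hr, Prod.mk.injEq] at h
    obtain ⟨h1, h2⟩ := h
    exact Prod.ext h2 (by omega)
  have hGr : G ∘ r = F := by
    funext jm
    simp [hG, hr, Function.comp]
  have hGzero : ∀ Nj, Nj ∉ Set.range r → G Nj = 0 := by
    intro Nj h
    simp only [hG]
    split_ifs with hle
    · exfalso; apply h
      exact ⟨(Nj.2, Nj.1 - 2 * Nj.2), Prod.ext (by simp [hr]; omega) (by simp [hr])⟩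
    · rfl
  have hF0 : ∀ jm, 0 ≤ F jm := by
    intro jm
    simp only [hF]
    have h1 := hc jm.1
    have h2 := chiralCoeff_nonneg (by positivity : (0 : ℝ) ≤ σ + 2 * jm.1) jm.2
    have h3 : 0 ≤ x ^ (σ + 2 * jm.1 + (jm.2 : ℝ)) := Real.rpow_nonneg hx.1.le _
    positivity
  have hG0 : ∀ Nj, 0 ≤ G Nj := by
    intro Nj; simp only [hG]; split_ifs; · exact hF0 _
    · exact le_rfl
  -- anti-diagonal (row-`N`) sums of `G`
  have hrow : ∀ N : ℕ, HasSum (fun j : ℕ => G (N, j)) (famCoeff σ c N * x ^ (σ + (N : ℝ))) := by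
    intro N
    have hfin : ∀ j ∉ range (N + 1), G (N, j) = 0 := by
      intro j hj
      rw [Finset.mem_range] at hj
      simp [hG, show ¬ 2 * j ≤ N by omega]
    have hval : ∑ j ∈ range (N + 1), G (N, j) = famCoeff σ c N * x ^ (σ + (N : ℝ)) := by
      rw [famCoeff, sum_mul]
      refine sum_congr rfl fun j _ => ?_
      simp only [hG, hF, shiftCoeff]
      split_ifs with hle
      · rw [Nat.cast_sub hle]
        push_cast
        rw [show σ + 2 * (j : ℝ) + ((N : ℝ) - 2 * j) = σ + N by ring]
        ring
      · simp
    rw [← hval]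
    exact hasSum_sum_of_ne_finset_zero hfin
  have hGs : Summable G := by
    refine (summable_prod_of_nonneg hG0).2 ⟨fun N => (hrow N).summable, ?_⟩
    exact hdiag.summable.congr fun N => ((hrow N).tsum_eq).symm
  have hGsum : HasSum G (x ^ σ * (1 / (1 - x) ^ (1 / 8 : ℝ) * W)) := by
    have h1 := hGs.hasSum
    have h2 := h1.prod_fiberwise hrow
    rwa [h2.unique hdiag] at h1
  have hFsum : HasSum F (x ^ σ * (1 / (1 - x) ^ (1 / 8 : ℝ) * W)) := by
    rw [← hGr]
    exact (hrinj.hasSum_iff hGzero).2 hGsum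
  -- row sums of `F` are the blocks
  have hFrow : ∀ j : ℕ, HasSum (fun m : ℕ => F (j, m)) (c j * chiralBlock (σ + 2 * j) x) := by
    intro j
    exact ((hasSum_chiralBlock (σ + 2 * j) hx.1 hx.2).mul_left (c j)).congr_fun fun m => rfl
  exact hFsum.prod_fiberwise hFrow

/-- **`Σ_j A_j k_{4j}(x) = f₁(x)`** on `0 < x < 1`: the quasi-primary expansion of the `c = 1/2` identity
block. [cite: BelavinPolyakovZamolodchikov1984, App. E] -/
theorem hasSum_isingA_blocks (hx : x ∈ Ioo (0 : ℝ) 1) :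
    HasSum (fun j : ℕ => isingA j * chiralBlock (2 * j) x) (isingF₁ x) := by
  have h := hasSum_blocks_of_famCoeff le_rfl isingA_nonneg famCoeff_isingA hx (hasSum_isingW₁ hx)
  rw [Real.rpow_zero, one_mul] at h
  unfold isingF₁
  refine h.congr_fun fun j => ?_
  rw [zero_add]

/-- **`Σ_j B_j k_{4j+1}(x) = f₂(x)`** on `0 < x < 1`: the quasi-primary expansion of the `c = 1/2` `ε` block.
[cite: BelavinPolyakovZamolodchikov1984, App. E] -/
theorem hasSum_isingB_blocks (hx : x ∈ Ioo (0 : ℝ) 1) :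
    HasSum (fun j : ℕ => isingB j * chiralBlock (1 / 2 + 2 * j) x) (isingF₂ x) := by
  have h := hasSum_blocks_of_famCoeff (by norm_num : (0 : ℝ) ≤ 1 / 2) isingB_nonneg famCoeff_isingB hx
    (hasSum_isingW₂ hx)
  have hs : 0 < Real.sqrt x := Real.sqrt_pos.mpr hx.1
  have e : x ^ (1 / 2 : ℝ) * (1 / (1 - x) ^ (1 / 8 : ℝ) * (isingW₂ x / Real.sqrt x)) = isingF₂ x := by
    rw [← Real.sqrt_eq_rpow, isingF₂]
    field_simp
  rwa [e] at h

end Tonelli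

end Summit.CriticalPhenomena.Ising3D.Control2D
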